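import Mathlib
import Summits.NavierStokesRegularity.NavierStokesRegularity.Theorems.SubcriticalEnvelopeForwardSourceTailEnvelopeKPOfBlockWake
import Summits.NavierStokesRegularity.NavierStokesRegularity.Theorems.OrthantWakeDyadicBreakBelowOneOfShellBarrier
import HarnessLib

/-!
# `OrthantWake.DyadicBreakBelowOne` (item stmt-NavierStokesRegularity-24644) is CONTAINED in each
# of the three open cruxes of the KP cluster of rung TL-M2Break (documentary edges, `--supports`)

Item 24644 (`OrthantWake.DyadicBreakBelowOne`: `∀ ε₀ ∈ (0,1), ∀ X₀, ¬ NoGlobalCascade ε₀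
dyadicTable X₀` — Barbato–Morandin–Romito's Theorem 1 for the viscous Katz–Pavlović chain at a
shell ratio `1+ε₀ < 2`; «open in print», arXiv:1506.07480 p. 3, certified in the tree on
`ε₀ ∈ [9/16, 1]` only, `not_noGlobalCascade_dyadicTable_of_ge_nine_sixteenths`) is the ONE-MODE
floor under the three open cruxes of the cluster:

* `SubOnsagerCeiling.ForwardTailCeilingKP` (stmt-27057, LEAD SOC) asks a `ν`-uniform sub-Onsager
  forward-tail ceiling for EVERY KP-proper orthant table at EVERY `ε₀ ∈ (0,1]`;
* `SubcriticalEnvelope.ForwardSourceTailEnvelopeKP` (stmt-27130, LEAD SE) asks a `ν`-uniform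
  subcritical forward-source envelope below a threshold `εs(R)`;
* `OrthantWake.KPBlockWake` (stmt-26999, this route, PARKED) asks the forward-source BLOCK
  ratchet below a threshold `ε̄(R)`.

This file pins the cluster's PRICE TAG of record (LEAD OW census v1 §B.1, KEY-NS #124 (B): «every
structural stub of any covering skeleton is ≥ the open-in-print one-mode problem») as three
kernel implications, each a by-name consumer of landed theorems — no new object, no certificate:

* `not_noGlobalCascade_dyadicTable_of_forwardTailCeilingKP` /
  `dyadicBreakBelowOne_of_forwardTailCeilingKP : ForwardTailCeilingKP → DyadicBreakBelowOne` —
  27057 contains the WHOLE item (every ratio in `(0,1)`, indeed `(0,1]`): at `α = dyadicTable ∈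
  E₂(2)` (`inTableClass_dyadicTable`, Kamke premise `dyadicSocket_kamke`, diagonal feeds by
  `dyadicTable_of_not`) the crux's mode set `S ⊇ S⁺(dyadicTable)` contains `0`
  (`dyadicTable 0 0 0 (0,0,1) = 1`), so the one-term tail `k = n` of its ceiling is the weighted
  shell bound `(1+ε₀)^{2θn}·½X_{0,n}² ≤ C·E₀`, `θ > 1/2`, i.e. the hypothesis of the socket
  `not_noGlobalCascade_dyadicTable_of_weightBound` (p626421) with `w = θ`
  (`weightBound_of_shellBound`);
* `dyadicBreakBelowOne_small_of_forwardSourceTailEnvelopeKP` — 27130 contains the item on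
  `(0, εs(2)]`: its envelope at `α = dyadicTable` is verbatim the hypothesis of the landed crux
  `OrthantWake.ForwardSourceSmoothing` (`forwardSourceSmoothing_proof`), whence a global regular
  `ν`-viscous solution for every `ν > 0` and `¬ NoGlobalCascade` by `hasGlobal_of_viscousGlobal`,
  `hasGlobal_mono`, `noGlobalCascade_iff_kappa`;
* `dyadicBreakBelowOne_small_of_kpBlockWake` — 26999 contains the item on `(0, ε̄(2)]`: the landed
  glue `kpBreakOfBlockWake_proof` (stmt-27001) fed with `orthantInvariance_proof` and
  `forwardSourceSmoothing_proof`, specialised to the dyadic member.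

IMPORTS (precedents of record): the SubOnsagerCeiling cone enters exactly as in p635069 (through
`OrthantWakeDyadicBreakBelowOneOfShellBarrier` → `SubOnsagerCeilingDefs`), the SubcriticalEnvelope
cone exactly as in p624862 (through `SubcriticalEnvelopeForwardSourceTailEnvelopeKPOfBlockWake`,
the landed edge 26999 ⇒ 27130); no Theses file is imported directly.

HONEST FRAMING: statements about a MODEL lattice ODE (routes OrthantWake / SubOnsagerCeiling /
SubcriticalEnvelope, rung TL-M2Break); three IMPLICATIONS whose hypotheses are OPEN cruxes —
nothing is proved about them.  THE FILE DOCUMENTS A GAP, NOT A PROOF: (a) quantifies over every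
`ε₀ ∈ (0,1)` CONDITIONALLY on 27057, while UNCONDITIONALLY item 24644 is proved in the tree only on
`[9/16, 1]` (`not_noGlobalCascade_dyadicTable_of_ge_nine_sixteenths`, p642585) and stays open on
`(0, 9/16)`.  Nothing here is a statement about the Navier–Stokes equations; no crux, rung target
or summit is proved.
[cite: BarbatoMorandinRomito2011, Thm. 1] [cite: Tao2016AveragedNS, §4 Thm. 4.2, Lemma 4.1]
-/

noncomputable section

set_option linter.dupNamespace false

namespace Summit.NavierStokesRegularity.NavierStokesRegularity.Theorems

open Set
open Literature.Analysis.FluidPDE.TaoCascade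
open Summit.NavierStokesRegularity.NavierStokesRegularity.Theses

/-- The dyadic member has DIAGONAL forward feed forms (its only non-zero `(0,0,1)` coefficient is
`dyadicTable 0 0 0 (0,0,1) = 1`): it is a Katz–Pavlović network proper in the sense of the rev-4
cruxes. MODEL lattice statement. [this file] -/
theorem dyadicTable_diagonalFeed :
    ∀ a b i : Fin 4, a ≠ b → dyadicTable a b i (0, 0, 1) = 0 := by
  intro a b i hab
  exact dyadicTable_of_not (by rintro ⟨ha, hb, -⟩; exact hab (ha.trans hb.symm))

/-- Every source-complete mode set of the dyadic member contains the chain mode `0`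
(`dyadicTable 0 0 0 (0,0,1) = 1 ≠ 0`). MODEL lattice statement. [this file] -/
theorem zero_mem_of_sourceComplete_dyadicTable {S : Finset (Fin 4)}
    (hS : ∀ i, i ∉ S → ∀ j l : Fin 4, dyadicTable i j l (0, 0, 1) = 0) : (0 : Fin 4) ∈ S := by
  by_contra h0
  have h := hS 0 h0 0 0
  simp [dyadicTable] at h

/-- **27057 contains item 24644 at every ratio.** If `SubOnsagerCeiling.ForwardTailCeilingKP`
holds then for every `ε₀ ∈ (0,1]` and every one-shell datum `X₀`,
`¬ NoGlobalCascade ε₀ dyadicTable X₀`: at `α = dyadicTable ∈ E₂(2)` the crux's mode set contains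
`0`, the one-term tail `k = n` of its `ν`-uniform ceiling is the weighted shell bound
`(1+ε₀)^{2θn}·½X_{0,n}(t)² ≤ C·E₀` with `θ > 1/2`, and the socket
`not_noGlobalCascade_dyadicTable_of_weightBound` concludes with `w = θ`, `C' = √(2·C·E₀)`.
MODEL lattice statement (an implication from an OPEN crux). [this file] -/
theorem not_noGlobalCascade_dyadicTable_of_forwardTailCeilingKP
    (h : SubOnsagerCeiling.ForwardTailCeilingKP) {ε₀ : ℝ} (hε₀ : 0 < ε₀) (hε₁ : ε₀ ≤ 1)
    (X₀ : Fin 4 → ℝ) : ¬ NoGlobalCascade ε₀ dyadicTable X₀ := by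
  obtain ⟨S, hS, θ, hθ, C, _hC, hceil⟩ := h 2 (by norm_num) ε₀ hε₀ hε₁ dyadicTable
    (inTableClass_dyadicTable le_rfl) dyadicSocket_kamke dyadicTable_diagonalFeed
  have h0S : (0 : Fin 4) ∈ S := zero_mem_of_sourceComplete_dyadicTable hS
  apply not_noGlobalCascade_dyadicTable_of_weightBound hε₀
  intro ν hν
  refine ⟨θ, Real.sqrt (2 * C * ∑ j : Fin 4, (1 / 2 : ℝ) * X₀ j ^ 2), hθ, ?_⟩
  intro s hs X hinit hlow hbd hcont hder hnonneg n t ht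
  have hb0 : (0 : ℝ) < 1 + ε₀ := by linarith
  have hc := hceil ν hν X₀ s hs X hinit hlow hbd hcont hder hnonneg n n le_rfl t ht
  rw [Finset.Icc_self, Finset.sum_singleton] at hc
  -- single out component `0` of the `S`-sum at shell `n`
  have h0 : (1 / 2 : ℝ) * X 0 (n : ℤ) t ^ 2 ≤ ∑ i ∈ S, (1 / 2 : ℝ) * X i (n : ℤ) t ^ 2 :=
    Finset.single_le_sum (f := fun i => (1 / 2 : ℝ) * X i (n : ℤ) t ^ 2)
      (fun i _ => by positivity) h0S
  have hw : 0 < (1 + ε₀) ^ (2 * θ * (n : ℝ)) := Real.rpow_pos_of_pos hb0 _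
  have hinv : (1 + ε₀) ^ (2 * θ * (n : ℝ)) * (1 + ε₀) ^ (-(2 * θ * (n : ℝ))) = 1 := by
    rw [← Real.rpow_add hb0, add_neg_cancel, Real.rpow_zero]
  apply weightBound_of_shellBound hb0 (D := C)
  calc (1 + ε₀) ^ (2 * θ * (n : ℝ)) * ((1 / 2 : ℝ) * X 0 (n : ℤ) t ^ 2)
      ≤ (1 + ε₀) ^ (2 * θ * (n : ℝ)) *
          (C * (∑ i : Fin 4, (1 / 2 : ℝ) * X₀ i ^ 2) * (1 + ε₀) ^ (-(2 * θ * (n : ℝ)))) :=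
        mul_le_mul_of_nonneg_left (h0.trans hc) hw.le
    _ = C * (∑ i : Fin 4, (1 / 2 : ℝ) * X₀ i ^ 2) *
          ((1 + ε₀) ^ (2 * θ * (n : ℝ)) * (1 + ε₀) ^ (-(2 * θ * (n : ℝ)))) := by ring
    _ = C * ∑ j : Fin 4, (1 / 2 : ℝ) * X₀ j ^ 2 := by rw [hinv, mul_one]

/-- **`ForwardTailCeilingKP → DyadicBreakBelowOne`** (27057 ⇒ the whole of item 24644): the route
SubOnsagerCeiling's deciding crux contains Barbato–Morandin–Romito's one-mode problem at EVERY
shell ratio in `(1, 2)`.  An IMPLICATION between OPEN statements — it documents a gap, not a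
proof: unconditionally the item is proved only on `ε₀ ∈ [9/16, 1]`
(`not_noGlobalCascade_dyadicTable_of_ge_nine_sixteenths`, p642585) and is open on `(0, 9/16)`.
MODEL lattice statement. [this file] -/
theorem dyadicBreakBelowOne_of_forwardTailCeilingKP (h : SubOnsagerCeiling.ForwardTailCeilingKP) :
    OrthantWake.DyadicBreakBelowOne := by
  unfold OrthantWake.DyadicBreakBelowOne
  intro ε₀ hε₀ hε₁ X₀
  exact not_noGlobalCascade_dyadicTable_of_forwardTailCeilingKP h hε₀ hε₁.le X₀

/-- **27130 contains item 24644 at every small ratio.** If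
`SubcriticalEnvelope.ForwardSourceTailEnvelopeKP` holds then there is `εs > 0` (its threshold at
spread `2`) such that for every `ε₀ ∈ (0, εs]` and every one-shell datum,
`¬ NoGlobalCascade ε₀ dyadicTable X₀`: the crux's `ν`-uniform subcritical envelope of the
`S`-partial tails at `α = dyadicTable ∈ E₂(2)` is verbatim the hypothesis of the landed crux
`OrthantWake.ForwardSourceSmoothing` (`forwardSourceSmoothing_proof`) at each viscosity
`ν = κ/√2`, whence a global regular viscous solution, `HasGlobal ε₀ dyadicTable κ κ 0 X₀` for every
`κ > 0` (`hasGlobal_of_viscousGlobal`, `hasGlobal_mono`) and the normal form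
`noGlobalCascade_iff_kappa`. MODEL lattice statement (an implication from an OPEN crux). [this file] -/
theorem dyadicBreakBelowOne_small_of_forwardSourceTailEnvelopeKP
    (h : SubcriticalEnvelope.ForwardSourceTailEnvelopeKP) :
    ∃ εs : ℝ, 0 < εs ∧ ∀ ε₀ : ℝ, 0 < ε₀ → ε₀ ≤ εs → ∀ X₀ : Fin 4 → ℝ,
      ¬ NoGlobalCascade ε₀ dyadicTable X₀ := by
  obtain ⟨εs, hεs, H⟩ := h 2 (by norm_num)
  refine ⟨εs, hεs, fun ε₀ hε₀ hle X₀ => ?_⟩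
  obtain ⟨S, hS, HX⟩ := H ε₀ hε₀ hle dyadicTable (inTableClass_dyadicTable le_rfl)
    dyadicSocket_kamke dyadicTable_diagonalFeed
  obtain ⟨η, hη, Hη⟩ := HX X₀
  intro hNG
  obtain ⟨κ, hκ, hno⟩ := (noGlobalCascade_iff_kappa hε₀).1 hNG
  have h2 : 0 < Real.sqrt 2 := Real.sqrt_pos.2 two_pos
  have hν : 0 < κ / Real.sqrt 2 := div_pos hκ h2
  have hB := forwardSourceSmoothing_proof
  unfold Summit.NavierStokesRegularity.NavierStokesRegularity.Theses.OrthantWake.ForwardSourceSmoothing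
    at hB
  obtain ⟨X, hX⟩ := hB ε₀ η 2 hε₀ hη dyadicTable (inTableClass_dyadicTable le_rfl) S hS X₀
    (κ / Real.sqrt 2) hν
    (fun T hT => by
      obtain ⟨C, HC⟩ := Hη T hT
      exact ⟨C, fun s hs Y hinit hlow hbd hcont hder n N hnN t ht =>
        HC (κ / Real.sqrt 2) hν s hs Y hinit hlow hbd hcont hder n N hnN t ht⟩)
  have hG := hasGlobal_of_viscousGlobal hε₀ hν.le hX
  rw [div_mul_cancel₀ κ h2.ne'] at hG
  exact hno (hasGlobal_mono hε₀.le hG le_rfl hκ.le)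

/-- **26999 contains item 24644 at every small ratio.** If `OrthantWake.KPBlockWake` holds then
there is `ε̄ > 0` (the glue's threshold at spread `2`) such that for every `ε₀ ∈ (0, ε̄]` and every
one-shell datum, `¬ NoGlobalCascade ε₀ dyadicTable X₀`: the landed glue `kpBreakOfBlockWake_proof`
(stmt-27001) fed with `orthantInvariance_proof` (stmt-24642) and `forwardSourceSmoothing_proof`
(stmt-26374), specialised to the dyadic member `dyadicTable ∈ E₂(2)` (Kamke premise
`dyadicSocket_kamke`, diagonal feeds `dyadicTable_diagonalFeed`). In words: the PARKED crux is,
already on the one-mode chain, a `ν`-uniform statement implying global regularity of the critical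
viscous dyadic lattice at every small shell ratio — the open-in-print floor of the cluster.
MODEL lattice statement (an implication from an OPEN crux). [this file] -/
theorem dyadicBreakBelowOne_small_of_kpBlockWake (h : OrthantWake.KPBlockWake) :
    ∃ εb : ℝ, 0 < εb ∧ ∀ ε₀ : ℝ, 0 < ε₀ → ε₀ ≤ εb → ∀ X₀ : Fin 4 → ℝ,
      ¬ NoGlobalCascade ε₀ dyadicTable X₀ := by
  obtain ⟨εR, hεR, H⟩ :=
    kpBreakOfBlockWake_proof h orthantInvariance_proof forwardSourceSmoothing_proof 2 (by norm_num)
  exact ⟨εR, hεR, fun ε₀ hε₀ hle X₀ =>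
    H ε₀ hε₀ hle dyadicTable X₀ (inTableClass_dyadicTable le_rfl) dyadicSocket_kamke
      dyadicTable_diagonalFeed⟩

end Summit.NavierStokesRegularity.NavierStokesRegularity.Theorems

end
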